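import Summits.AnomalousDissipation.AnomalousDissipation.Theorems.SawtoothPulseCascadeK1LocalisedCascadeWindowBlockCTG
import Summits.AnomalousDissipation.AnomalousDissipation.Theorems.SawtoothPulseCascadeK1LocalisedCascadeClassBlockCTE

/-!
# K1loc — helper: ONE FIBRE BLOCK OF A CLASS STEP IN ALL-ORDERS CORNER-TRACE GRADE («CT-GEO» block; port of `…ClassBlockCTE`)

Helper file of the prover lane on the crux `K1LocalisedCascade` (stmt-AnomalousDissipation-19491), route `SawtoothPulseCascade`
(S-D fibre ledger, corner-trace track; finding F-p1g9-1, memo v15).  `…WindowBlockCTG.sum_window_iterate_{v,h}step_ctg_boxE_le` on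
the block `W ∩ {Λ ≤ |k_fibre| < Λt}` of a window with a BOX cross-section `|k_window| ≤ K` on that block, the symmetric box trapezoid
(plateau `L`, ramps `R`, `L + R ≥ 2`), the integer gap `D = ΛG − K − (L+R) ≥ 1` (so the window sits `≥ D` below the near edge of
the lobe packet of the bottom fibre), order `p ≥ 1`, `ε > 0`, zone parameter `M`, rounding `ε_r ≥ e^{−M²/2}`, and the block's
tracked energy `E`:
  `Σ_{block} |𝓕a_{j+1}|² ≤ (√(c₁·r* + c₂E) + √((πΛtGε_r/N)²E + 8Mδ_jr*/π) + √(Σ'_{Λ≤|k₁|<Λt, L<|k₀|}|𝓕b_j|²))²`,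
`r* = (2L+R)/R` (as `(√((2L+R)R)/R)²/2 + (·)/2`), `c₁ = (1+ε)(N²/π²)τ(ΛG−(L+R−1), K)`, `c₂` the order-`p` remainder coefficient at gap `D`.
No definitions; nothing about the crux. [cite: Grafakos2014, Prop. 3.1.2 (5), Prop. 3.2.7 (3)] [problem: turb]
-/

-- `Summit.<Summit>.<Problem>`: single-conjunct summit, the duplicate namespace segment is deliberate.
set_option linter.dupNamespace false

noncomputable section

namespace Summit.AnomalousDissipation.AnomalousDissipation.Theorems.SawtoothPulseCascade.K1Window

open MeasureTheory Set Filter Topology UnitAddTorus Function Complex Metric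
open scoped Real ENNReal
open Literature.Analysis Literature.Analysis.FunctionSpaces Literature.Analysis.FunctionSpaces.Torus Literature.Analysis.FluidPDE
open Literature.Analysis.FluidPDE.ShearStage
open Literature.Analysis.FluidPDE.SawtoothCascade Literature.Analysis.FluidPDE.SawtoothCascade.CascadeParams
open Summit.AnomalousDissipation.AnomalousDissipation.Theorems.SawtoothPulseCascade.K1Start
open Summit.AnomalousDissipation.AnomalousDissipation.Theorems.SawtoothPulseCascade.K1Flat
open Summit.AnomalousDissipation.AnomalousDissipation.Theorems.SawtoothPulseCascade.K1Ledger.From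

section Cascade

variable (P : CascadeParams)

set_option maxHeartbeats 800000 in
/-- **One fibre block of a V-window of `a_{j+1}`, CT-GEO grade, tracked energy symbolic** (see the file header): block
`W ∩ {Λ ≤ |k₁| < Λt}` with `|k₀| ≤ K` there, `K + (L+R) + 1 ≤ ΛG`. [cite: Grafakos2014, Prop. 3.1.2 (5), Prop. 3.2.7 (3)] -/
theorem sum_block_iterate_vstep_ctg_le {G : ℕ} (hγ : P.γ = G) (hδ₀ : 0 < P.δ₀) (hd : 0 < P.d) (hN₀ : 1 ≤ P.N₀)
    (hρN : 1 ≤ P.ρN) (a b : ℕ → UnitAddTorus (Fin 2) → ℝ) (has : ∀ j, IsSmooth (a j)) (h0 : a 0 = datum)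
    (hb : ∀ j, b j = a j ∘ shearMap 0 1 (amp ⟨P.U j, P.U_periodic j, P.contDiff_U (P.δ_pos hδ₀ hd j)⟩ P.γ))
    (hab : ∀ j, a (j + 1) = b j ∘ shearMap 1 0 (amp ⟨P.U j, P.U_periodic j, P.contDiff_U (P.δ_pos hδ₀ hd j)⟩ P.γ))
    (j : ℕ) (W : Finset (Fin 2 → ℤ)) {Λ Λt L R K : ℕ} (hΛt : 1 ≤ Λt) (hR : 0 < R) (hLR : 2 ≤ L + R)
    (hWK : ∀ k ∈ W, (Λ : ℤ) ≤ |k 1| → |k 1| < (Λt : ℤ) → |k 0| ≤ (K : ℤ)) (hgap : K + (L + R) + 1 ≤ Λ * G)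
    (hWsym : ∀ k ∈ W, Function.update k 1 (-k 1) ∈ W)
    {p : ℕ} (hp : 1 ≤ p) {ε M εr : ℝ} (hε : 0 < ε) (hM : 1 ≤ M) (hMδ : M * P.δ j < π / 2) (hεr : Real.exp (-(M ^ 2 / 2)) ≤ εr)
    {E : ℝ} (hE : ∑ n ∈ (W.filter (fun k => (Λ : ℤ) ≤ |k 1| ∧ |k 1| < (Λt : ℤ))).image (fun k => k 1),
      ∑ l ∈ Finset.Icc (-((L + R : ℕ) : ℤ)) (L + R : ℕ), ‖mFourierCoeff (fun x => (b j x : ℂ)) ![l, n]‖ ^ 2 ≤ E) :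
    ∑ k ∈ W.filter (fun k => (Λ : ℤ) ≤ |k 1| ∧ |k 1| < (Λt : ℤ)), ‖mFourierCoeff (fun x => (a (j + 1) x : ℂ)) k‖ ^ 2 ≤
      (Real.sqrt ((1 + ε) * ((P.N j : ℝ) ^ 2 / π ^ 2) *
              (8 * ((Λ : ℝ) * G - (((L + R : ℕ) : ℝ) - 1)) ^ 2 / (((Λ : ℝ) * G - (((L + R : ℕ) : ℝ) - 1)) ^ 2 - (K : ℝ) ^ 2) ^ 2 +
                8 * ((K : ℝ) + 1 / 2) / (P.N j * (((Λ : ℝ) * G - (((L + R : ℕ) : ℝ) - 1)) ^ 2 - ((K : ℝ) + 1 / 2) ^ 2))) *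
              ((Real.sqrt ((2 * L + R : ℕ) * R) / R * 1) ^ 2 / 2 + (Real.sqrt ((2 * L + R : ℕ) * R) / R * 1) ^ 2 / 2) +
            (1 + ε⁻¹) * ((P.N j : ℝ) ^ 2 / π ^ 2) * (4 / (((Λ * G - K - (L + R) : ℕ) : ℝ)) ^ 2 *
              (1 / ((((Λ * G - K - (L + R) : ℕ) : ℝ)) + ((L + R : ℕ) : ℝ)) ^ (2 * p) +
                1 / (P.N j * ((((Λ * G - K - (L + R) : ℕ) : ℝ)) + ((L + R : ℕ) : ℝ)) ^ (2 * p - 1)))) *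
              ((2 * ((L + R : ℕ) : ℝ) / P.N j + 1) * ((L + R : ℕ) : ℝ) ^ (2 * p)) * E) +
          Real.sqrt ((π * ((Λt * G : ℕ) : ℝ) * εr / P.N j) ^ 2 * E +
            8 * M * P.δ j / π * ((Real.sqrt ((2 * L + R : ℕ) * R) / R * 1) ^ 2 / 2 +
              (Real.sqrt ((2 * L + R : ℕ) * R) / R * 1) ^ 2 / 2)) +
        Real.sqrt (∑' k : Fin 2 → ℤ, (if (Λ : ℤ) ≤ |k 1| ∧ |k 1| < (Λt : ℤ) ∧ (L : ℤ) < |k 0| then (1 : ℝ) else 0) *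
          ‖mFourierCoeff (fun x => (b j x : ℂ)) k‖ ^ 2)) ^ 2 := by
  classical
  have hNpos : 0 < P.N j := N_pos P hN₀ hρN j
  have hNr : (0 : ℝ) < P.N j := by exact_mod_cast hNpos
  have hεr0 : 0 ≤ εr := (Real.exp_pos _).le.trans hεr
  have hE0 : 0 ≤ E := le_trans (Finset.sum_nonneg fun _ _ => Finset.sum_nonneg fun _ _ => sq_nonneg _) hE
  set Wm : Finset (Fin 2 → ℤ) := W.filter (fun k => (Λ : ℤ) ≤ |k 1| ∧ |k 1| < (Λt : ℤ)) with hWm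
  have hmem : ∀ k ∈ Wm, k ∈ W ∧ (Λ : ℤ) ≤ |k 1| ∧ |k 1| < (Λt : ℤ) := fun k hk => by
    simpa [hWm, Finset.mem_filter] using hk
  have hcast : (((Λt - 1 : ℕ) : ℤ)) = (Λt : ℤ) - 1 := by push_cast [Nat.cast_sub hΛt]; ring
  have hW' : ∀ k ∈ Wm, (Λ : ℤ) ≤ |k 1| ∧ |k 1| ≤ ((Λt - 1 : ℕ) : ℤ) := fun k hk => by
    obtain ⟨-, h1, h2⟩ := hmem k hk
    exact ⟨h1, by rw [hcast]; exact Int.le_sub_one_iff.mpr h2⟩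
  have hWK' : ∀ k ∈ Wm, |k 0| ≤ (K : ℤ) := fun k hk => by
    obtain ⟨hkW, h1, h2⟩ := hmem k hk; exact hWK k hkW h1 h2
  -- the integer gap
  set D : ℕ := Λ * G - K - (L + R) with hDdef
  have hD0 : 0 < D := by rw [hDdef]; omega
  have hKD : (K : ℤ) + ((L + R : ℕ) : ℤ) + D ≤ (Λ : ℤ) * G := by
    have : K + (L + R) + D ≤ Λ * G := by rw [hDdef]; omega
    exact_mod_cast this
  have hedge : (K : ℝ) + 1 ≤ (Λ : ℝ) * G - (((L + R : ℕ) : ℝ) - 1) := by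
    have : ((K + (L + R) + 1 : ℕ) : ℝ) ≤ ((Λ * G : ℕ) : ℝ) := by exact_mod_cast hgap
    push_cast at this ⊢
    linarith
  have hWsym' : ∀ n ∈ Wm.image (fun k => k 1), -n ∈ Wm.image (fun k => k 1) := by
    intro n hn
    obtain ⟨k, hk, rfl⟩ := Finset.mem_image.mp hn
    obtain ⟨hkW, h1, h2⟩ := hmem k hk
    refine Finset.mem_image.mpr ⟨Function.update k 1 (-k 1), ?_, by simp⟩
    refine Finset.mem_filter.mpr ⟨hWsym k hkW, ?_⟩
    simpa [abs_neg] using And.intro h1 h2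
  have h := sum_window_iterate_vstep_ctg_boxE_le P hγ hδ₀ hd hN₀ hρN a b has h0 hb hab j hR hLR hD0 Wm hW' hWK' hKD hedge hWsym'
    hp hε hM hMδ hεr hE
  -- the block top in the rounding term; the half-open pass-through class
  have hle : (((Λt - 1) * G : ℕ) : ℝ) ≤ ((Λt * G : ℕ) : ℝ) := by exact_mod_cast Nat.mul_le_mul_right G (Nat.sub_le Λt 1)
  have hR2 : (π * (((Λt - 1) * G : ℕ) : ℝ) * εr / P.N j) ^ 2 * E +
        8 * M * P.δ j / π * ((Real.sqrt ((2 * L + R : ℕ) * R) / R * 1) ^ 2 / 2 +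
          (Real.sqrt ((2 * L + R : ℕ) * R) / R * 1) ^ 2 / 2) ≤
      (π * ((Λt * G : ℕ) : ℝ) * εr / P.N j) ^ 2 * E +
        8 * M * P.δ j / π * ((Real.sqrt ((2 * L + R : ℕ) * R) / R * 1) ^ 2 / 2 +
          (Real.sqrt ((2 * L + R : ℕ) * R) / R * 1) ^ 2 / 2) := by
    refine add_le_add (mul_le_mul_of_nonneg_right (pow_le_pow_left₀ (by positivity)
      (div_le_div_of_nonneg_right (mul_le_mul_of_nonneg_right
        (mul_le_mul_of_nonneg_left hle Real.pi_pos.le) hεr0) hNr.le) 2) hE0) le_rfl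
  have hPT : ∑' k : Fin 2 → ℤ, (if (Λ : ℤ) ≤ |k 1| ∧ |k 1| ≤ ((Λt - 1 : ℕ) : ℤ) ∧ (L : ℤ) < |k 0| then (1 : ℝ) else 0) *
        ‖mFourierCoeff (fun x => (b j x : ℂ)) k‖ ^ 2 =
      ∑' k : Fin 2 → ℤ, (if (Λ : ℤ) ≤ |k 1| ∧ |k 1| < (Λt : ℤ) ∧ (L : ℤ) < |k 0| then (1 : ℝ) else 0) *
        ‖mFourierCoeff (fun x => (b j x : ℂ)) k‖ ^ 2 := by
    refine tsum_congr fun k => ?_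
    congr 1
    refine if_congr ?_ rfl rfl
    rw [hcast, Int.le_sub_one_iff]
  rw [hPT] at h
  exact h.trans (pow_le_pow_left₀ (by positivity)
    (add_le_add (add_le_add le_rfl (Real.sqrt_le_sqrt hR2)) le_rfl) 2)

set_option maxHeartbeats 800000 in
/-- **One fibre block of an H-window of `b_j`, CT-GEO grade, tracked energy symbolic**: block `W ∩ {Λ ≤ |k₀| < Λt}` with
`|k₁| ≤ K` there (sources in `k₁`), `K + (L+R) + 1 ≤ ΛG`. [cite: Grafakos2014, Prop. 3.1.2 (5), Prop. 3.2.7 (3)] -/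
theorem sum_block_iterate_hstep_ctg_le {G : ℕ} (hγ : P.γ = G) (hδ₀ : 0 < P.δ₀) (hd : 0 < P.d) (hN₀ : 1 ≤ P.N₀)
    (hρN : 1 ≤ P.ρN) (a b : ℕ → UnitAddTorus (Fin 2) → ℝ) (has : ∀ j, IsSmooth (a j)) (h0 : a 0 = datum)
    (hb : ∀ j, b j = a j ∘ shearMap 0 1 (amp ⟨P.U j, P.U_periodic j, P.contDiff_U (P.δ_pos hδ₀ hd j)⟩ P.γ))
    (hab : ∀ j, a (j + 1) = b j ∘ shearMap 1 0 (amp ⟨P.U j, P.U_periodic j, P.contDiff_U (P.δ_pos hδ₀ hd j)⟩ P.γ))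
    (j : ℕ) (W : Finset (Fin 2 → ℤ)) {Λ Λt L R K : ℕ} (hΛt : 1 ≤ Λt) (hR : 0 < R) (hLR : 2 ≤ L + R)
    (hWK : ∀ k ∈ W, (Λ : ℤ) ≤ |k 0| → |k 0| < (Λt : ℤ) → |k 1| ≤ (K : ℤ)) (hgap : K + (L + R) + 1 ≤ Λ * G)
    (hWsym : ∀ k ∈ W, Function.update k 0 (-k 0) ∈ W)
    {p : ℕ} (hp : 1 ≤ p) {ε M εr : ℝ} (hε : 0 < ε) (hM : 1 ≤ M) (hMδ : M * P.δ j < π / 2) (hεr : Real.exp (-(M ^ 2 / 2)) ≤ εr)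
    {E : ℝ} (hE : ∑ n ∈ (W.filter (fun k => (Λ : ℤ) ≤ |k 0| ∧ |k 0| < (Λt : ℤ))).image (fun k => k 0),
      ∑ l ∈ Finset.Icc (-((L + R : ℕ) : ℤ)) (L + R : ℕ), ‖mFourierCoeff (fun x => (a j x : ℂ)) ![n, l]‖ ^ 2 ≤ E) :
    ∑ k ∈ W.filter (fun k => (Λ : ℤ) ≤ |k 0| ∧ |k 0| < (Λt : ℤ)), ‖mFourierCoeff (fun x => (b j x : ℂ)) k‖ ^ 2 ≤
      (Real.sqrt ((1 + ε) * ((P.N j : ℝ) ^ 2 / π ^ 2) *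
              (8 * ((Λ : ℝ) * G - (((L + R : ℕ) : ℝ) - 1)) ^ 2 / (((Λ : ℝ) * G - (((L + R : ℕ) : ℝ) - 1)) ^ 2 - (K : ℝ) ^ 2) ^ 2 +
                8 * ((K : ℝ) + 1 / 2) / (P.N j * (((Λ : ℝ) * G - (((L + R : ℕ) : ℝ) - 1)) ^ 2 - ((K : ℝ) + 1 / 2) ^ 2))) *
              ((Real.sqrt ((2 * L + R : ℕ) * R) / R * 1) ^ 2 / 2 + (Real.sqrt ((2 * L + R : ℕ) * R) / R * 1) ^ 2 / 2) +
            (1 + ε⁻¹) * ((P.N j : ℝ) ^ 2 / π ^ 2) * (4 / (((Λ * G - K - (L + R) : ℕ) : ℝ)) ^ 2 *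
              (1 / ((((Λ * G - K - (L + R) : ℕ) : ℝ)) + ((L + R : ℕ) : ℝ)) ^ (2 * p) +
                1 / (P.N j * ((((Λ * G - K - (L + R) : ℕ) : ℝ)) + ((L + R : ℕ) : ℝ)) ^ (2 * p - 1)))) *
              ((2 * ((L + R : ℕ) : ℝ) / P.N j + 1) * ((L + R : ℕ) : ℝ) ^ (2 * p)) * E) +
          Real.sqrt ((π * ((Λt * G : ℕ) : ℝ) * εr / P.N j) ^ 2 * E +
            8 * M * P.δ j / π * ((Real.sqrt ((2 * L + R : ℕ) * R) / R * 1) ^ 2 / 2 +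
              (Real.sqrt ((2 * L + R : ℕ) * R) / R * 1) ^ 2 / 2)) +
        Real.sqrt (∑' k : Fin 2 → ℤ, (if (Λ : ℤ) ≤ |k 0| ∧ |k 0| < (Λt : ℤ) ∧ (L : ℤ) < |k 1| then (1 : ℝ) else 0) *
          ‖mFourierCoeff (fun x => (a j x : ℂ)) k‖ ^ 2)) ^ 2 := by
  classical
  have hNpos : 0 < P.N j := N_pos P hN₀ hρN j
  have hNr : (0 : ℝ) < P.N j := by exact_mod_cast hNpos
  have hεr0 : 0 ≤ εr := (Real.exp_pos _).le.trans hεr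
  have hE0 : 0 ≤ E := le_trans (Finset.sum_nonneg fun _ _ => Finset.sum_nonneg fun _ _ => sq_nonneg _) hE
  set Wm : Finset (Fin 2 → ℤ) := W.filter (fun k => (Λ : ℤ) ≤ |k 0| ∧ |k 0| < (Λt : ℤ)) with hWm
  have hmem : ∀ k ∈ Wm, k ∈ W ∧ (Λ : ℤ) ≤ |k 0| ∧ |k 0| < (Λt : ℤ) := fun k hk => by
    simpa [hWm, Finset.mem_filter] using hk
  have hcast : (((Λt - 1 : ℕ) : ℤ)) = (Λt : ℤ) - 1 := by push_cast [Nat.cast_sub hΛt]; ring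
  have hW' : ∀ k ∈ Wm, (Λ : ℤ) ≤ |k 0| ∧ |k 0| ≤ ((Λt - 1 : ℕ) : ℤ) := fun k hk => by
    obtain ⟨-, h1, h2⟩ := hmem k hk
    exact ⟨h1, by rw [hcast]; exact Int.le_sub_one_iff.mpr h2⟩
  have hWK' : ∀ k ∈ Wm, |k 1| ≤ (K : ℤ) := fun k hk => by
    obtain ⟨hkW, h1, h2⟩ := hmem k hk; exact hWK k hkW h1 h2
  set D : ℕ := Λ * G - K - (L + R) with hDdef
  have hD0 : 0 < D := by rw [hDdef]; omega
  have hKD : (K : ℤ) + ((L + R : ℕ) : ℤ) + D ≤ (Λ : ℤ) * G := by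
    have : K + (L + R) + D ≤ Λ * G := by rw [hDdef]; omega
    exact_mod_cast this
  have hedge : (K : ℝ) + 1 ≤ (Λ : ℝ) * G - (((L + R : ℕ) : ℝ) - 1) := by
    have : ((K + (L + R) + 1 : ℕ) : ℝ) ≤ ((Λ * G : ℕ) : ℝ) := by exact_mod_cast hgap
    push_cast at this ⊢
    linarith
  have hWsym' : ∀ n ∈ Wm.image (fun k => k 0), -n ∈ Wm.image (fun k => k 0) := by
    intro n hn
    obtain ⟨k, hk, rfl⟩ := Finset.mem_image.mp hn
    obtain ⟨hkW, h1, h2⟩ := hmem k hk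
    refine Finset.mem_image.mpr ⟨Function.update k 0 (-k 0), ?_, by simp⟩
    refine Finset.mem_filter.mpr ⟨hWsym k hkW, ?_⟩
    simpa [abs_neg] using And.intro h1 h2
  have h := sum_window_iterate_hstep_ctg_boxE_le P hγ hδ₀ hd hN₀ hρN a b has h0 hb hab j hR hLR hD0 Wm hW' hWK' hKD hedge hWsym'
    hp hε hM hMδ hεr hE
  have hle : (((Λt - 1) * G : ℕ) : ℝ) ≤ ((Λt * G : ℕ) : ℝ) := by exact_mod_cast Nat.mul_le_mul_right G (Nat.sub_le Λt 1)
  have hR2 : (π * (((Λt - 1) * G : ℕ) : ℝ) * εr / P.N j) ^ 2 * E +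
        8 * M * P.δ j / π * ((Real.sqrt ((2 * L + R : ℕ) * R) / R * 1) ^ 2 / 2 +
          (Real.sqrt ((2 * L + R : ℕ) * R) / R * 1) ^ 2 / 2) ≤
      (π * ((Λt * G : ℕ) : ℝ) * εr / P.N j) ^ 2 * E +
        8 * M * P.δ j / π * ((Real.sqrt ((2 * L + R : ℕ) * R) / R * 1) ^ 2 / 2 +
          (Real.sqrt ((2 * L + R : ℕ) * R) / R * 1) ^ 2 / 2) := by
    refine add_le_add (mul_le_mul_of_nonneg_right (pow_le_pow_left₀ (by positivity)
      (div_le_div_of_nonneg_right (mul_le_mul_of_nonneg_right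
        (mul_le_mul_of_nonneg_left hle Real.pi_pos.le) hεr0) hNr.le) 2) hE0) le_rfl
  have hPT : ∑' k : Fin 2 → ℤ, (if (Λ : ℤ) ≤ |k 0| ∧ |k 0| ≤ ((Λt - 1 : ℕ) : ℤ) ∧ (L : ℤ) < |k 1| then (1 : ℝ) else 0) *
        ‖mFourierCoeff (fun x => (a j x : ℂ)) k‖ ^ 2 =
      ∑' k : Fin 2 → ℤ, (if (Λ : ℤ) ≤ |k 0| ∧ |k 0| < (Λt : ℤ) ∧ (L : ℤ) < |k 1| then (1 : ℝ) else 0) *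
        ‖mFourierCoeff (fun x => (a j x : ℂ)) k‖ ^ 2 := by
    refine tsum_congr fun k => ?_
    congr 1
    refine if_congr ?_ rfl rfl
    rw [hcast, Int.le_sub_one_iff]
  rw [hPT] at h
  exact h.trans (pow_le_pow_left₀ (by positivity)
    (add_le_add (add_le_add le_rfl (Real.sqrt_le_sqrt hR2)) le_rfl) 2)

end Cascade

end Summit.AnomalousDissipation.AnomalousDissipation.Theorems.SawtoothPulseCascade.K1Window
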